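import Mathlib
import Summits.Ventures.HodgeRepro.Tier4.Line4.TorusFinSplit
import Summits.Ventures.HodgeRepro.Tier4.Common.HaarProductTransport

/-!
# Tier4/Line4/TorusFinSplitHaar — Haar measure along the `S`-split `T_f ≃ₜ* T_S × T_f^{(S)}`, `S` a set of finite places
(C-L4-PSPLIT, Part A.3)

Blind re-derivation cell `pub-hodge-repro`, Tier 4 «prove the step» (README §9–§10), seat t4-L2-p1 (gen 3; plan-4 g5's cut
C-L4-PSPLIT S15510, statement S15526).  Tree path `lean/Summits/Ventures/HodgeRepro/Tier4/Line4/TorusFinSplitHaar.lean`.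
Imports `Line4/TorusFinSplit` (the split and the topology of its factors) and typer-1's generic
`Common/HaarProductTransport` (`isHaarMeasure_map_symm_prod`, `exists_smul_map_symm_prod_eq`, `integral_eq_smul_integral_prod`
along a `≃ₜ*` onto a product of locally compact second countable groups).  No `def`; no literature.

* `isHaarMeasure_map_torusFinSplit_symm_prod`: the transported product `ν_S ⊗ ν^{(S)}` is a Haar measure on `T_f`;
* **`exists_smul_map_prod_eq_fin`** (the Haar transport of S15510 (1)): every Haar measure `ν_f` on `T_f` is a positive multiple
  `c • (torusFinSplit W S).symm_*(ν_S ⊗ ν^{(S)})`;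
* `integral_eq_smul_integral_prod_fin`: `∫_{T_f} F dν_f = c ∫_{T_S} ∫_{T_f^{(S)}} F(x y) dν^{(S)} dν_S` for integrable `F`;
* the `T′` twins.

Nothing here says anything about the status of the Hodge conjecture for CM abelian varieties, which is NOT proved
(HC_CM is NOT proved by anyone in this repository).
-/

set_option autoImplicit false
noncomputable section
namespace Summit.Ventures.HodgeRepro.Tier4.Line4
open Summit.Ventures.HodgeRepro.Tier4 Summit.Ventures.HodgeRepro.Tier4.Common
  Summit.Ventures.HodgeRepro.Tier4.Line1 NumberField IsDedekindDomain MeasureTheory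
open scoped NumberField NNReal

section Haar
variable {k : Type} [Field k] [NumberField k] (W : PlaneData k) (S : Set (HeightOneSpectrum (𝓞 k)))
  [MeasurableSpace (torusT W)] [BorelSpace (torusT W)]

/-- The product of Haar measures on `T_S`, `T_f^{(S)}`, transported along the `S`-split, is a Haar measure on `T_f`. -/
theorem isHaarMeasure_map_torusFinSplit_symm_prod
    (νv : Measure (torusFinAt W S)) [νv.IsHaarMeasure] (νaway : Measure (torusFinAway W S)) [νaway.IsHaarMeasure] :
    (Measure.map (torusFinSplit W S).symm (νv.prod νaway)).IsHaarMeasure := by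
  haveI := secondCountable_torusFinAt W S
  haveI := secondCountable_torusFinAway W S
  haveI := locallyCompact_torusFinAt W S
  haveI := locallyCompact_torusFinAway W S
  exact Summit.Ventures.HodgeRepro.Tier4.Common.isHaarMeasure_map_symm_prod (torusFinSplit W S) νv νaway

/-- **HAAR UNIQUENESS ALONG THE `v`-SPLIT**: a Haar measure `ν_f` on `T_f` is a positive multiple of the transported
product `ν_S ⊗ ν^{(S)}`. -/
theorem exists_smul_map_prod_eq_fin (νf : Measure (torusFin W)) [νf.IsHaarMeasure]
    (νv : Measure (torusFinAt W S)) [νv.IsHaarMeasure] (νaway : Measure (torusFinAway W S)) [νaway.IsHaarMeasure] :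
    ∃ c : ℝ≥0, 0 < c ∧ νf = c • Measure.map (torusFinSplit W S).symm (νv.prod νaway) := by
  haveI := locallyCompact_torusFin W
  haveI := secondCountable_torusFin W
  haveI := secondCountable_torusFinAt W S
  haveI := secondCountable_torusFinAway W S
  haveI := locallyCompact_torusFinAt W S
  haveI := locallyCompact_torusFinAway W S
  exact Summit.Ventures.HodgeRepro.Tier4.Common.exists_smul_map_symm_prod_eq (torusFinSplit W S) νf νv νaway

/-- **THE `T_f`-INTEGRAL AS AN ITERATED `T_S × T_f^{(S)}` INTEGRAL**: for `ν_f = c • (ν_S ⊗ ν^{(S)})` and an integrable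
`F`, `∫_{T_f} F dν_f = c ∫_{T_S} ∫_{T_f^{(S)}} F(x y) dν^{(S)} dν_S`. -/
theorem integral_eq_smul_integral_prod_fin (νf : Measure (torusFin W)) [νf.IsHaarMeasure]
    (νv : Measure (torusFinAt W S)) [νv.IsHaarMeasure] (νaway : Measure (torusFinAway W S)) [νaway.IsHaarMeasure]
    (c : ℝ≥0) (hc : νf = c • Measure.map (torusFinSplit W S).symm (νv.prod νaway))
    (F : torusFin W → ℂ) (hF : Integrable F νf) :
    ∫ b, F b ∂νf = (c : ℝ) • ∫ x, ∫ y, F ((x : torusFin W) * (y : torusFin W)) ∂νaway ∂νv := by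
  haveI := secondCountable_torusFinAt W S
  haveI := secondCountable_torusFinAway W S
  haveI := locallyCompact_torusFinAt W S
  haveI := locallyCompact_torusFinAway W S
  exact Summit.Ventures.HodgeRepro.Tier4.Common.integral_eq_smul_integral_prod (torusFinSplit W S) νf νv νaway c hc F hF

end Haar

section Haar'
variable {k : Type} [Field k] [NumberField k] (W : PlaneData k) (S : Set (HeightOneSpectrum (𝓞 k)))
  [MeasurableSpace (torusT' W)] [BorelSpace (torusT' W)]

/-- The `T′` twin of `isHaarMeasure_map_torusFinSplit_symm_prod`. -/
theorem isHaarMeasure_map_torusFinSplit'_symm_prod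
    (νv : Measure (torusFinAt' W S)) [νv.IsHaarMeasure] (νaway : Measure (torusFinAway' W S)) [νaway.IsHaarMeasure] :
    (Measure.map (torusFinSplit' W S).symm (νv.prod νaway)).IsHaarMeasure := by
  haveI := secondCountable_torusFinAt' W S
  haveI := secondCountable_torusFinAway' W S
  haveI := locallyCompact_torusFinAt' W S
  haveI := locallyCompact_torusFinAway' W S
  exact Summit.Ventures.HodgeRepro.Tier4.Common.isHaarMeasure_map_symm_prod (torusFinSplit' W S) νv νaway

/-- The `T′` twin of `exists_smul_map_prod_eq_fin`. -/
theorem exists_smul_map_prod_eq_fin' (νf' : Measure (torusFin' W)) [νf'.IsHaarMeasure]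
    (νv : Measure (torusFinAt' W S)) [νv.IsHaarMeasure] (νaway : Measure (torusFinAway' W S)) [νaway.IsHaarMeasure] :
    ∃ c : ℝ≥0, 0 < c ∧ νf' = c • Measure.map (torusFinSplit' W S).symm (νv.prod νaway) := by
  haveI := locallyCompact_torusFin' W
  haveI := secondCountable_torusFin' W
  haveI := secondCountable_torusFinAt' W S
  haveI := secondCountable_torusFinAway' W S
  haveI := locallyCompact_torusFinAt' W S
  haveI := locallyCompact_torusFinAway' W S
  exact Summit.Ventures.HodgeRepro.Tier4.Common.exists_smul_map_symm_prod_eq (torusFinSplit' W S) νf' νv νaway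

/-- The `T′` twin of `integral_eq_smul_integral_prod_fin`. -/
theorem integral_eq_smul_integral_prod_fin' (νf' : Measure (torusFin' W)) [νf'.IsHaarMeasure]
    (νv : Measure (torusFinAt' W S)) [νv.IsHaarMeasure] (νaway : Measure (torusFinAway' W S)) [νaway.IsHaarMeasure]
    (c : ℝ≥0) (hc : νf' = c • Measure.map (torusFinSplit' W S).symm (νv.prod νaway))
    (F : torusFin' W → ℂ) (hF : Integrable F νf') :
    ∫ b, F b ∂νf' = (c : ℝ) • ∫ x, ∫ y, F ((x : torusFin' W) * (y : torusFin' W)) ∂νaway ∂νv := by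
  haveI := secondCountable_torusFinAt' W S
  haveI := secondCountable_torusFinAway' W S
  haveI := locallyCompact_torusFinAt' W S
  haveI := locallyCompact_torusFinAway' W S
  exact Summit.Ventures.HodgeRepro.Tier4.Common.integral_eq_smul_integral_prod (torusFinSplit' W S) νf' νv νaway c hc F hF

end Haar'

end Summit.Ventures.HodgeRepro.Tier4.Line4

end
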